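import Summits.AtomisticToContinuum.HydrodynamicLimit.Theorems.LambertianContactSwapContactAngleEquidistributionCampbellTimeDep
import Summits.AtomisticToContinuum.HydrodynamicLimit.Theorems.LambertianContactSwapContactAngleEquidistributionFluxMidpoint
import Summits.AtomisticToContinuum.HydrodynamicLimit.Theorems.LambertianContactSwapContactAngleEquidistributionFibreCentring
import Summits.AtomisticToContinuum.HydrodynamicLimit.Theorems.LambertianContactSwapContactAngleEquidistributionNearFieldBall
import Summits.AtomisticToContinuum.HydrodynamicLimit.Theorems.LambertianContactSwapContactAngleEquidistributionMeas
import HarnessLib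

/-!
# Exact equilibrium centring of the isolated stratum (stub `stub_costEqCentring`, line `Sketch`,
# skeleton v4, crux `LambertianContactSwap.ContactAngleEquidistribution`, stmt-AtomisticToContinuum-12097;
# lead `prover-line-stmt-AtomisticToContinuum-12097-c1-0`)

WHAT. Under the homogeneous Gibbs law `Q_N = localGibbsLaw σ 1 0 θe N (Φ N)` the mean of the ISOLATED
(no third centre within `3ε` of the contact midpoint), speed-capped, `κ_g`-centred, `|g|²`-weighted
contact-angle hit-sum of the crux functional is EXACTLY `0` for every `N` (`stub_costEqCentring`),
conditionally on the named fact `HardSphereCampbellFormula` (CIP 1994 App. 4.A), like the whole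
equilibrium layer of the line.

HOW. A reusable PRINCIPLE (`integral_hitSum_eq_zero_of_fibre`): for a bounded, jointly measurable REAL
mark `F (s, y, i, j)` whose midpoint-fibre cosine fluxes of `ρ_N F⁺` and `ρ_N F⁻` agree for all `s`,
`i ≠ j`, `z` (FIBRE HYPOTHESIS), `E_{Q_N}[Σ_{m<Kt} Σ_{ij} [hit] F (tcol, zpre, i, j)] = 0`: split
`F = F⁺ − F⁻` termwise; both hit-sums are measurable (`stub_meas`) and integrable (dominated by `B ×` the
`|g|³`-weighted count, `stub_nearFieldFinite`); by time-dependent Campbell (`stub_campbellTimeDep`) their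
means are time integrals of outgoing fluxes of `ρ_N [i<j] F^±(s, collidePair ·)`; the Gibbs weight is
invariant under the elastic reflection (`canonicalDensity_collidePair_const`), so `stub_fluxMidpoint` passes
to incoming midpoint / normal coordinates, where the hypothesis identifies the two signs
(`outgoingCollisionFlux_pre_congr`). COROLLARY (`stub_costEqCentring`): the isolated capped centred mark is
jointly measurable (NearField kit), bounded by `2V²`, and its fibre hypothesis is `stub_fibreCentring`.

References: C. Cercignani, R. Illner, M. Pulvirenti, *The Mathematical Theory of Dilute Gases* (1994), App. 4.A, §4.2.
-/

noncomputable section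

open MeasureTheory Filter Set Topology ProbabilityTheory
open scoped ENNReal BigOperators Classical RealInnerProductSpace

namespace Summit.AtomisticToContinuum.HydrodynamicLimit.Theorems.ContactAngleEquidistributionSketch

open Literature.Analysis.FluidPDE Literature.MathematicalPhysics.KineticTheory

namespace EqCentring

/-- `ofReal` of a selected positive part is the selected `ofReal` (`Decidable` instances are implicit
arguments, filled by unification, here and below). [folklore] -/
theorem ofReal_ite_max {p : Prop} {ip ip' : Decidable p} (a : ℝ) :
    ENNReal.ofReal (@ite _ p ip (max a 0) 0) = @ite _ p ip' (ENNReal.ofReal a) 0 := by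
  by_cases hp : p
  · simp only [if_pos hp]
    rcases le_total a 0 with h | h
    · rw [max_eq_right h, ENNReal.ofReal_zero, ENNReal.ofReal_of_nonpos h]
    · rw [max_eq_left h]
  · simp only [if_neg hp, ENNReal.ofReal_zero]

/-- A selected term is the difference of its selected positive and negative parts. [folklore] -/
theorem ite_eq_sub {p : Prop} {ip ip₁ ip₂ : Decidable p} (a : ℝ) :
    @ite _ p ip a 0 = @ite _ p ip₁ (max a 0) 0 - @ite _ p ip₂ (max (-a) 0) 0 := by
  by_cases hp : p
  · simp only [if_pos hp, max_zero_sub_max_neg_zero_eq_self]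
  · simp only [if_neg hp, sub_zero]

/-- A selected positive part of a term bounded by `B` is at most `B ×` the selected weight `1 + x³`.
[folklore] -/
theorem abs_ite_max_le {p : Prop} {ip ip' : Decidable p} {a B x : ℝ} (ha : |a| ≤ B) (hx : 0 ≤ x) :
    |@ite _ p ip (max a 0) 0| ≤ B * @ite _ p ip' (1 + x ^ 3) 0 := by
  have hB : 0 ≤ B := (abs_nonneg a).trans ha
  by_cases hp : p
  · simp only [if_pos hp]
    rw [abs_of_nonneg (le_max_right _ _)]
    calc max a 0 ≤ B * 1 := by rw [mul_one]; exact max_le ((le_abs_self a).trans ha) hB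
      _ ≤ B * (1 + x ^ 3) := by gcongr; linarith [pow_nonneg hx 3]
  · simp only [if_neg hp, abs_zero, mul_zero, le_refl]

/-- The isolated capped mark `[¬near] [¬(V < x)] x² d`, `|d| ≤ 2`, is bounded by `2V²`. [folklore] -/
theorem abs_ite_cap_le {p q : Prop} {ip : Decidable p} {iq : Decidable q} {x d V : ℝ} (hx : 0 ≤ x)
    (hq : ¬q → x ≤ V) (hd : |d| ≤ 2) : |@ite _ p ip 0 (@ite _ q iq 0 (x ^ 2 * d))| ≤ 2 * V ^ 2 := by
  by_cases hp : p
  · simp only [if_pos hp, abs_zero]; positivity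
  · simp only [if_neg hp]
    by_cases hq' : q
    · simp only [if_pos hq', abs_zero]; positivity
    · simp only [if_neg hq']
      rw [abs_mul, abs_pow, abs_of_nonneg hx, mul_comm 2 (V ^ 2)]
      exact mul_le_mul (pow_le_pow_left₀ hx (hq hq') 2) hd (abs_nonneg _) (sq_nonneg _)

/-- Nonnegativity of a triple sum of nonnegative terms. [folklore] -/
theorem sum3_nonneg {ι : Type*} (K : Finset ι) (n : ℕ) (f : ι → Fin n → Fin n → ℝ)
    (h : ∀ m i j, 0 ≤ f m i j) : 0 ≤ ∑ m ∈ K, ∑ i : Fin n, ∑ j : Fin n, f m i j :=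
  Finset.sum_nonneg fun m _ => Finset.sum_nonneg fun i _ => Finset.sum_nonneg fun j _ => h m i j

/-- Termwise domination of a triple sum. [folklore] -/
theorem abs_sum3_le {ι : Type*} (K : Finset ι) (n : ℕ) (κ : ℝ) (f g : ι → Fin n → Fin n → ℝ)
    (h : ∀ m i j, |f m i j| ≤ κ * g m i j) :
    |∑ m ∈ K, ∑ i : Fin n, ∑ j : Fin n, f m i j| ≤ κ * ∑ m ∈ K, ∑ i : Fin n, ∑ j : Fin n, g m i j := by
  simp only [Finset.mul_sum]
  exact (Finset.abs_sum_le_sum_abs _ _).trans (Finset.sum_le_sum fun m _ =>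
    (Finset.abs_sum_le_sum_abs _ _).trans (Finset.sum_le_sum fun i _ =>
      (Finset.abs_sum_le_sum_abs _ _).trans (Finset.sum_le_sum fun j _ => h m i j)))

/-- Termwise splitting of a triple sum as a difference. [folklore] -/
theorem sum3_eq_sub {ι : Type*} (K : Finset ι) (n : ℕ) (f a b : ι → Fin n → Fin n → ℝ)
    (h : ∀ m i j, f m i j = a m i j - b m i j) :
    ∑ m ∈ K, ∑ i : Fin n, ∑ j : Fin n, f m i j =
      ∑ m ∈ K, ∑ i : Fin n, ∑ j : Fin n, a m i j - ∑ m ∈ K, ∑ i : Fin n, ∑ j : Fin n, b m i j := by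
  simp only [← Finset.sum_sub_distrib]
  exact Finset.sum_congr rfl fun m _ => Finset.sum_congr rfl fun i _ =>
    Finset.sum_congr rfl fun j _ => h m i j

/-- `ofReal` of a triple sum of nonnegative reals, termwise. [folklore] -/
theorem ofReal_sum3 {ι : Type*} (K : Finset ι) (n : ℕ) (f : ι → Fin n → Fin n → ℝ)
    (g : ι → Fin n → Fin n → ℝ≥0∞) (h0 : ∀ m i j, 0 ≤ f m i j)
    (h : ∀ m i j, ENNReal.ofReal (f m i j) = g m i j) :
    ENNReal.ofReal (∑ m ∈ K, ∑ i : Fin n, ∑ j : Fin n, f m i j) =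
      ∑ m ∈ K, ∑ i : Fin n, ∑ j : Fin n, g m i j := by
  rw [ENNReal.ofReal_sum_of_nonneg fun m _ =>
    Finset.sum_nonneg fun i _ => Finset.sum_nonneg fun j _ => h0 m i j]
  refine Finset.sum_congr rfl fun m _ => ?_
  rw [ENNReal.ofReal_sum_of_nonneg fun i _ => Finset.sum_nonneg fun j _ => h0 m i j]
  refine Finset.sum_congr rfl fun i _ => ?_
  rw [ENNReal.ofReal_sum_of_nonneg fun j _ => h0 m i j]
  exact Finset.sum_congr rfl fun j _ => h m i j

/-- **`∫ f = 0` by positive / negative parts.** If `f = g₁ − g₂` with `g₁, g₂ ≥ 0` measurable,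
dominated by a multiple of a measurable weight `W ≥ 0` of finite lower integral, and `∫⁻ g₁ = ∫⁻ g₂`,
then `∫ f = 0`. [folklore] -/
theorem integral_eq_zero_of_parts {α : Type*} [MeasurableSpace α] {μ : Measure α}
    {f g₁ g₂ W : α → ℝ} (hW : ∫⁻ z, ENNReal.ofReal (W z) ∂μ ≠ ⊤) (h₁m : Measurable g₁)
    (h₂m : Measurable g₂) (hWm : Measurable W) (c : ℝ) (hW0 : ∀ z, 0 ≤ W z)
    (h₁W : ∀ z, |g₁ z| ≤ c * W z) (h₂W : ∀ z, |g₂ z| ≤ c * W z) (h₁0 : ∀ z, 0 ≤ g₁ z)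
    (h₂0 : ∀ z, 0 ≤ g₂ z) (hf : ∀ z, f z = g₁ z - g₂ z)
    (h : ∫⁻ z, ENNReal.ofReal (g₁ z) ∂μ = ∫⁻ z, ENNReal.ofReal (g₂ z) ∂μ) : ∫ z, f z ∂μ = 0 := by
  have hWi : Integrable W μ :=
    ⟨hWm.aestronglyMeasurable, (hasFiniteIntegral_iff_ofReal (ae_of_all _ hW0)).2 hW.lt_top⟩
  have hint : ∀ {g : α → ℝ}, Measurable g → (∀ z, |g z| ≤ c * W z) → Integrable g μ :=
    fun hgm hgW => (hWi.const_mul c).mono' hgm.aestronglyMeasurable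
      (ae_of_all _ fun z => by rw [Real.norm_eq_abs]; exact hgW z)
  calc ∫ z, f z ∂μ = ∫ z, g₁ z - g₂ z ∂μ := integral_congr_ae (ae_of_all μ hf)
    _ = 0 := by
        rw [integral_sub (hint h₁m h₁W) (hint h₂m h₂W),
          integral_eq_lintegral_of_nonneg_ae (ae_of_all _ h₁0) h₁m.aestronglyMeasurable,
          integral_eq_lintegral_of_nonneg_ae (ae_of_all _ h₂0) h₂m.aestronglyMeasurable, h, sub_self]

end EqCentring

/-- **The homogeneous Gibbs density is invariant under the elastic reflection of a pair**: the
collision does not move the particles (same hard-core indicator) and conserves `Σ‖v_k − u‖²`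
(energy and momentum conservation). [folklore] -/
theorem canonicalDensity_collidePair_const (a θ : ℝ) (u : V3) {n : ℕ} (ε : ℝ) {i j : Fin n}
    (hij : i ≠ j) (w : Config n (Fin 3) T3) :
    canonicalDensity (Torus.geometry (Fin 3)) ε n (localGibbsProfile (fun _ => a) (fun _ => u) (fun _ => θ))
        (collidePair (Torus.geometry (Fin 3)) i j w) =
      canonicalDensity (Torus.geometry (Fin 3)) ε n (localGibbsProfile (fun _ => a) (fun _ => u) (fun _ => θ)) w := by
  have hD : collidePair (Torus.geometry (Fin 3)) i j w ∈ hardSphereDomain (Torus.geometry (Fin 3)) n ε ↔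
      w ∈ hardSphereDomain (Torus.geometry (Fin 3)) n ε :=
    mem_hardSphereDomain_congr_fst fun k => collidePair_apply_fst w k
  have hT : tensorPow n (localGibbsProfile (fun _ => a) (fun _ => u) (fun _ => θ))
        (collidePair (Torus.geometry (Fin 3)) i j w) =
      tensorPow n (localGibbsProfile (fun _ => a) (fun _ => u) (fun _ => θ)) w := by
    rw [tensorPow_localGibbsProfile_const, tensorPow_localGibbsProfile_const, sum_norm_vel_sub_sq_eq,
      sum_norm_vel_sub_sq_eq, configEnergy_collidePair hij, configMomentum_collidePair hij]
  unfold canonicalDensity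
  by_cases hw : w ∈ hardSphereDomain (Torus.geometry (Fin 3)) n ε
  · rw [indicator_of_mem hw, indicator_of_mem (hD.2 hw), hT]
  · rw [indicator_of_notMem hw, indicator_of_notMem (mt hD.1 hw)]

/-- **Outgoing fluxes of two Gibbs-weighted pre-collisional marks agree when their midpoint-fibre
cosine fluxes agree** (`0 < ε < 1/2`, measurable `F₁, F₂ ≥ 0`): pair by pair, the Gibbs weight is a
function of the pre-collisional configuration (`canonicalDensity_collidePair_const`), `stub_fluxMidpoint`
passes to midpoint / normal coordinates, and there the hypothesis applies. [cite: CIP1994, App. 4.A pp. 107–111] -/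
theorem outgoingCollisionFlux_pre_congr {N : ℕ} {ε : ℝ} (hε0 : 0 < ε) (hε : ε < 1 / 2) (θ : ℝ)
    (F₁ F₂ : Config N (Fin 3) T3 → Fin N → Fin N → ℝ≥0∞) (hF₁ : ∀ i j, Measurable fun y => F₁ y i j)
    (hF₂ : ∀ i j, Measurable fun y => F₂ y i j)
    (hfib : ∀ i j : Fin N, i ≠ j → ∀ z : Config N (Fin 3) T3,
      ∫⁻ ω : Metric.sphere (0 : V3) 1,
          ENNReal.ofReal (ε ^ (Fintype.card (Fin 3) - 1) * ⟪((ω : V3)), (z j).2 - (z i).2⟫) *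
            (hardSphereDomain (Torus.geometry (Fin 3)) N ε).indicator (fun y =>
                ENNReal.ofReal (canonicalDensity (Torus.geometry (Fin 3)) ε N
                  (localGibbsProfile (fun _ => 1) (fun _ => 0) (fun _ => θ)) y) * F₁ y i j)
              (Function.update (Function.update z i
                  ((z j).1 + Literature.Analysis.FunctionSpaces.Torus.proj ((ε / 2) • (ω : V3)), (z i).2)) j
                ((z j).1 + Literature.Analysis.FunctionSpaces.Torus.proj (-((ε / 2) • (ω : V3))), (z j).2))
          ∂(volume : Measure V3).toSphere =
        ∫⁻ ω : Metric.sphere (0 : V3) 1,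
          ENNReal.ofReal (ε ^ (Fintype.card (Fin 3) - 1) * ⟪((ω : V3)), (z j).2 - (z i).2⟫) *
            (hardSphereDomain (Torus.geometry (Fin 3)) N ε).indicator (fun y =>
                ENNReal.ofReal (canonicalDensity (Torus.geometry (Fin 3)) ε N
                  (localGibbsProfile (fun _ => 1) (fun _ => 0) (fun _ => θ)) y) * F₂ y i j)
              (Function.update (Function.update z i
                  ((z j).1 + Literature.Analysis.FunctionSpaces.Torus.proj ((ε / 2) • (ω : V3)), (z i).2)) j
                ((z j).1 + Literature.Analysis.FunctionSpaces.Torus.proj (-((ε / 2) • (ω : V3))), (z j).2))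
          ∂(volume : Measure V3).toSphere) :
    outgoingCollisionFlux ε N (fun w i j => ENNReal.ofReal (canonicalDensity (Torus.geometry (Fin 3)) ε N
        (localGibbsProfile (fun _ => 1) (fun _ => 0) (fun _ => θ)) w) *
        (if i < j then F₁ (collidePair (Torus.geometry (Fin 3)) i j w) i j else 0)) =
      outgoingCollisionFlux ε N (fun w i j => ENNReal.ofReal (canonicalDensity (Torus.geometry (Fin 3)) ε N
        (localGibbsProfile (fun _ => 1) (fun _ => 0) (fun _ => θ)) w) *
        (if i < j then F₂ (collidePair (Torus.geometry (Fin 3)) i j w) i j else 0)) := by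
  set cD := canonicalDensity (Torus.geometry (Fin 3)) ε N
    (localGibbsProfile (fun _ => 1) (fun _ => 0) (fun _ => θ)) with hcD
  have hρm : Measurable fun y : Config N (Fin 3) T3 => ENNReal.ofReal (cD y) :=
    (measurable_canonicalDensity ε N
      (measurable_localGibbsProfile continuous_const continuous_const continuous_const)).ennreal_ofReal
  simp only [outgoingCollisionFlux]
  refine Finset.sum_congr rfl fun i _ => Finset.sum_congr rfl fun j _ => ?_
  by_cases hlt : i < j
  · have hij : i ≠ j := ne_of_lt hlt
    simp only [if_neg hij, if_pos hlt]
    have hpre : ∀ (Fk : Config N (Fin 3) T3 → Fin N → Fin N → ℝ≥0∞) (w : Config N (Fin 3) T3),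
        ENNReal.ofReal (cD w) * Fk (collidePair (Torus.geometry (Fin 3)) i j w) i j =
          ENNReal.ofReal (cD (collidePair (Torus.geometry (Fin 3)) i j w)) *
            Fk (collidePair (Torus.geometry (Fin 3)) i j w) i j := fun Fk w => by
      rw [hcD, canonicalDensity_collidePair_const 1 θ 0 ε hij]
    simp only [hpre F₁, hpre F₂]
    rw [stub_fluxMidpoint hε0 hε hij (fun y => ENNReal.ofReal (cD y) * F₁ y i j) (hρm.mul (hF₁ i j)),
      stub_fluxMidpoint hε0 hε hij (fun y => ENNReal.ofReal (cD y) * F₂ y i j) (hρm.mul (hF₂ i j))]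
    exact lintegral_congr fun z => hfib i j hij z
  · simp only [if_neg hlt, mul_zero]

/-- **Equilibrium centring principle for real marked hit-sums** (line `Sketch` v4). Conditional on
`HardSphereCampbellFormula`: for `θe > 0` there is `σ₀ > 0` such that for `0 < σ < σ₀`, every family of
flows `Φ`, `t ≥ 0`, `N` and every bounded jointly measurable REAL mark `F (s, y, i, j)` satisfying the
FIBRE HYPOTHESIS (for all `s`, `i ≠ j`, `z`: the midpoint-fibre cosine fluxes of `ρ_N F⁺` and `ρ_N F⁻`
agree), the `Q_N`-mean of the hit-sum `Σ_{m < Kt z t} Σ_{ij} [hit] F (tcol z m, zpre z m, i, j)` is `0`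
(`F = F⁺ − F⁻`; `stub_nearFieldFinite`, `stub_campbellTimeDep`, `outgoingCollisionFlux_pre_congr`).
[cite: CIP1994, App. 4.A pp. 107–111] -/
theorem integral_hitSum_eq_zero_of_fibre (hC : HardSphereCampbellFormula) :
    let Cfg : ℕ → Type := fun N => Config (N + 1) (Fin 3) T3
    let G := Torus.geometry (Fin 3)
    let ε : ℝ → ℕ → ℝ := hsDiameter
    let τ : ℝ → (N : ℕ) → Cfg N → ℝ≥0∞ := fun σ N z => Alexander.freeExitTime G (ε σ N) z
    let S : ℝ → (N : ℕ) → Cfg N → Cfg N := fun t _ z => freeFlight G t z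
    let zpre : ℝ → (N : ℕ) → Cfg N → ℕ → Cfg N := fun σ N z m =>
      let y := Alexander.stateAfter G (ε σ N) z m; S (τ σ N y).toReal N y
    let Kt : ℝ → (N : ℕ) → Cfg N → ℝ → ℕ := fun σ N z t => Alexander.collisionCount G (ε σ N) z t
    let hit : ℝ → (N : ℕ) → Cfg N → Fin (N + 1) → Fin (N + 1) → Prop := fun σ N y i j =>
      i < j ∧ y ∈ contactSet G (N + 1) (ε σ N) i j ∧ IsIncoming G y i j
    let tcol : ℝ → (N : ℕ) → Cfg N → ℕ → ℝ := fun σ N z m =>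
      (Alexander.collisionInstant G (ε σ N) z (m + 1)).toReal
    let mid : ℝ → (N : ℕ) → Cfg N → Fin (N + 1) → Fin (N + 1) → V3 → Cfg N := fun σ N z i j ω =>
      Function.update (Function.update z i
          ((z j).1 + Literature.Analysis.FunctionSpaces.Torus.proj ((ε σ N / 2) • ω), (z i).2)) j
        ((z j).1 + Literature.Analysis.FunctionSpaces.Torus.proj (-((ε σ N / 2) • ω)), (z j).2)
    ∀ θe : ℝ, 0 < θe → ∃ σ₀ : ℝ, 0 < σ₀ ∧ ∀ σ : ℝ, 0 < σ → σ < σ₀ →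
      ∀ Φ : (N : ℕ) → HardSphereFlow G (ε σ N) (N + 1),
      let Q := fun N => localGibbsLaw σ (fun _ => 1) (fun _ => 0) (fun _ => θe) N (Φ N)
      let ρ : (N : ℕ) → Cfg N → ℝ≥0∞ := fun N y => ENNReal.ofReal (canonicalDensity G (ε σ N) (N + 1)
        (localGibbsProfile (fun _ => 1) (fun _ => 0) (fun _ => θe)) y)
      ∀ t : ℝ, 0 ≤ t → ∀ (N : ℕ) (F : ℝ → Cfg N → Fin (N + 1) → Fin (N + 1) → ℝ),
        (∀ i j, Measurable fun p : ℝ × Cfg N => F p.1 p.2 i j) →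
        (∃ B : ℝ, ∀ s y i j, |F s y i j| ≤ B) →
        (∀ (s : ℝ) (i j : Fin (N + 1)), i ≠ j → ∀ z : Cfg N,
          ∫⁻ ω : Metric.sphere (0 : V3) 1,
              ENNReal.ofReal (ε σ N ^ (Fintype.card (Fin 3) - 1) * ⟪((ω : V3)), (z j).2 - (z i).2⟫) *
                (hardSphereDomain G (N + 1) (ε σ N)).indicator
                  (fun y => ρ N y * ENNReal.ofReal (F s y i j)) (mid σ N z i j ω)
              ∂(volume : Measure V3).toSphere =
            ∫⁻ ω : Metric.sphere (0 : V3) 1,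
              ENNReal.ofReal (ε σ N ^ (Fintype.card (Fin 3) - 1) * ⟪((ω : V3)), (z j).2 - (z i).2⟫) *
                (hardSphereDomain G (N + 1) (ε σ N)).indicator
                  (fun y => ρ N y * ENNReal.ofReal (-F s y i j)) (mid σ N z i j ω)
              ∂(volume : Measure V3).toSphere) →
        ∫ z, (∑ m ∈ Finset.range (Kt σ N z t), ∑ i : Fin (N + 1), ∑ j : Fin (N + 1),
            (let y := zpre σ N z m
             if hit σ N y i j then F (tcol σ N z m) y i j else 0)) ∂(Q N) = 0 := by
  dsimp (config := { zeta := true }) only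
  intro θe hθe
  have hW := stub_campbellTimeDep hC
  have hfin := stub_nearFieldFinite
  have hM := stub_meas
  dsimp (config := { zeta := true }) only at hW hfin hM
  obtain ⟨σ₁, hσ₁, hW⟩ := hW θe hθe
  obtain ⟨σ₂, hσ₂, hfin⟩ := hfin (fun _ => 1) (fun _ => θe) (fun _ => 0) continuous_const
    continuous_const continuous_const (fun _ => one_pos) (fun _ => hθe)
  refine ⟨min (min σ₁ σ₂) (1 / 2), lt_min (lt_min hσ₁ hσ₂) (by norm_num),
    fun σ hσ hσlt Φ t ht N F hF hB hfib => ?_⟩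
  obtain ⟨B, hB⟩ := hB
  have hσ1 : σ < σ₁ := (hσlt.trans_le (min_le_left _ _)).trans_le (min_le_left _ _)
  have hσ2' : σ < σ₂ := (hσlt.trans_le (min_le_left _ _)).trans_le (min_le_right _ _)
  have hσ2 : σ < 2⁻¹ := by rw [← one_div]; exact hσlt.trans_le (min_le_right _ _)
  have hεh : hsDiameter σ N < 1 / 2 := (hsDiameter_le hσ.le N).trans_lt (by rwa [one_div])
  have hc : (0 : ℝ) < ((N : ℝ) + 1) ^ (-(4 / 3 : ℝ)) := Real.rpow_pos_of_pos (by positivity) _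
  have hpre := fun m => NearField.measurable_zpre hσ hσ2 N m
  have hm₁ := hM σ hσ hσ2 N t (fun s y i j => max (F s y i j) 0) fun i j =>
    (hF i j).max measurable_const
  have hm₂ := hM σ hσ hσ2 N t (fun s y i j => max (-F s y i j) 0) fun i j =>
    (hF i j).fun_neg.max measurable_const
  refine EqCentring.integral_eq_zero_of_parts (hfin σ hσ hσ2' Φ t ht N) hm₁ hm₂ ?_
    (B / ((N : ℝ) + 1) ^ (-(4 / 3 : ℝ))) (fun z => ?_) (fun z => ?_) (fun z => ?_) (fun z => ?_)
    (fun z => ?_) (fun z => ?_) ?_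
  · exact (NearField.measurable_sum_range (NearField.measurable_Kt hσ hσ2 N t) fun m =>
      Finset.measurable_sum _ fun i _ => Finset.measurable_sum _ fun j _ =>
        Measurable.ite (NearField.measurableSet_hit _ (hpre m) i j) (measurable_const.fun_add
          (((NearField.measurable_vel' (hpre m) i).fun_sub
            (NearField.measurable_vel' (hpre m) j)).norm.pow_const 3)) measurable_const).const_mul _
  · exact mul_nonneg hc.le (EqCentring.sum3_nonneg _ _ _ fun m i j => by positivity)
  · rw [← mul_assoc, div_mul_cancel₀ B hc.ne']
    exact EqCentring.abs_sum3_le _ _ B _ _ fun m i j =>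
      EqCentring.abs_ite_max_le (hB _ _ _ _) (norm_nonneg _)
  · rw [← mul_assoc, div_mul_cancel₀ B hc.ne']
    exact EqCentring.abs_sum3_le _ _ B _ _ fun m i j =>
      EqCentring.abs_ite_max_le (by rw [abs_neg]; exact hB _ _ _ _) (norm_nonneg _)
  · exact EqCentring.sum3_nonneg _ _ _ fun m i j => by positivity
  · exact EqCentring.sum3_nonneg _ _ _ fun m i j => by positivity
  · exact EqCentring.sum3_eq_sub _ _ _ _ _ fun m i j => EqCentring.ite_eq_sub _
  · -- Campbell for both parts, then the flux identity pair by pair at every instant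
    have e₁ := hW σ hσ hσ1 Φ t ht N (fun s y i j => ENNReal.ofReal (F s y i j)) fun i j =>
      (hF i j).ennreal_ofReal
    have e₂ := hW σ hσ hσ1 Φ t ht N (fun s y i j => ENNReal.ofReal (-F s y i j)) fun i j =>
      (hF i j).fun_neg.ennreal_ofReal
    refine (((lintegral_congr fun z => ?_).trans e₁).trans (lintegral_congr fun s => ?_)).trans
      ((lintegral_congr fun z => ?_).trans e₂).symm
    · exact EqCentring.ofReal_sum3 _ _ _ _ (fun m i j => by positivity) fun m i j =>
        EqCentring.ofReal_ite_max _
    · exact outgoingCollisionFlux_pre_congr (hsDiameter_pos hσ N) hεh θe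
        (fun y i j => ENNReal.ofReal (F s y i j)) (fun y i j => ENNReal.ofReal (-F s y i j))
        (fun i j => ((hF i j).comp measurable_prodMk_left).ennreal_ofReal)
        (fun i j => ((hF i j).comp measurable_prodMk_left).fun_neg.ennreal_ofReal) fun i j hij z =>
        hfib s i j hij z
    · exact EqCentring.ofReal_sum3 _ _ _ _ (fun m i j => by positivity) fun m i j =>
        EqCentring.ofReal_ite_max _

/-- **Registered sub-goal `stub_costEqCentring`** (line `Sketch` v4, crux ContactAngleEquidistribution,
stmt-AtomisticToContinuum-12097): EXACT EQUILIBRIUM CENTRING of the isolated stratum — under the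
homogeneous Gibbs law `Q_N` the mean of the isolated (midpoint-ball), capped, `κ_g`-centred
contact-angle hit-sum is `0` for EVERY `N` (conditional on `HardSphereCampbellFormula`): the mark is
jointly measurable, bounded by `2V²`, with fibre hypothesis `stub_fibreCentring`. [cite: CIP1994, App. 4.A pp. 107–111] -/
theorem stub_costEqCentring (hC : HardSphereCampbellFormula) :
    let Cfg : ℕ → Type := fun N => Config (N + 1) (Fin 3) T3
    let G := Torus.geometry (Fin 3)
    let ε : ℝ → ℕ → ℝ := hsDiameter
    let τ : ℝ → (N : ℕ) → Cfg N → ℝ≥0∞ := fun σ N z => Alexander.freeExitTime G (ε σ N) z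
    let S : ℝ → (N : ℕ) → Cfg N → Cfg N := fun t _ z => freeFlight G t z
    let ldir : V3 → V3 → V3 := fun ω ξ => ‖‖ω‖⁻¹ • ω + ‖ξ‖⁻¹ • ξ‖⁻¹ • (‖ω‖⁻¹ • ω + ‖ξ‖⁻¹ • ξ)
    let zpre : ℝ → (N : ℕ) → Cfg N → ℕ → Cfg N := fun σ N z m =>
      let y := Alexander.stateAfter G (ε σ N) z m; S (τ σ N y).toReal N y
    let Kt : ℝ → (N : ℕ) → Cfg N → ℝ → ℕ := fun σ N z t => Alexander.collisionCount G (ε σ N) z t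
    let hit : ℝ → (N : ℕ) → Cfg N → Fin (N + 1) → Fin (N + 1) → Prop := fun σ N y i j =>
      i < j ∧ y ∈ contactSet G (N + 1) (ε σ N) i j ∧ IsIncoming G y i j
    let tcol : ℝ → (N : ℕ) → Cfg N → ℕ → ℝ := fun σ N z m =>
      (Alexander.collisionInstant G (ε σ N) z (m + 1)).toReal
    let xmid : (N : ℕ) → Cfg N → Fin (N + 1) → Fin (N + 1) → T3 := fun _ y i j =>
      G.translate (y j).1 ((2 : ℝ)⁻¹ • G.sepVec (y i).1 (y j).1)
    let near : ℝ → (N : ℕ) → Cfg N → Fin (N + 1) → Fin (N + 1) → Prop := fun σ N y i j =>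
      ∃ k : Fin (N + 1), k ≠ i ∧ k ≠ j ∧ ‖G.sepVec (y k).1 (xmid N y i j)‖ ≤ 3 * ε σ N
    ∀ θe : ℝ, 0 < θe → ∃ σ₀ : ℝ, 0 < σ₀ ∧ ∀ σ : ℝ, 0 < σ → σ < σ₀ →
      ∀ Φ : (N : ℕ) → HardSphereFlow G (ε σ N) (N + 1),
      let Q := fun N => localGibbsLaw σ (fun _ => 1) (fun _ => 0) (fun _ => θe) N (Φ N)
      ∀ t : ℝ, 0 ≤ t → ∀ V : ℝ, 0 < V →
      ∀ ψ : ℕ → ℝ → T3 → V3 → V3 → V3 → ℝ,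
        (∀ N, Measurable (fun p : ℝ × T3 × V3 × V3 × V3 =>
          ψ N p.1 p.2.1 p.2.2.1 p.2.2.2.1 p.2.2.2.2)) →
        (∀ N s x v w n, |ψ N s x v w n| ≤ 1) →
        ∀ N : ℕ, ∫ z, ((N : ℝ) + 1) ^ (-(4 / 3 : ℝ)) *
          ∑ m ∈ Finset.range (Kt σ N z t), ∑ i : Fin (N + 1), ∑ j : Fin (N + 1),
            (let y := zpre σ N z m
             if hit σ N y i j then
               (if near σ N y i j then 0 else if V < ‖(y i).2 - (y j).2‖ then 0 else
                 ‖(y i).2 - (y j).2‖ ^ 2 *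
                   (ψ N (tcol σ N z m) (xmid N y i j) (y i).2 (y j).2
                       ((ε σ N)⁻¹ • G.sepVec (y i).1 (y j).1) -
                     ∫ ξ, ψ N (tcol σ N z m) (xmid N y i j) (y i).2 (y j).2
                       (ldir (-((y i).2 - (y j).2)) ξ) ∂(stdGaussian V3)))
             else 0) ∂(Q N) = 0 := by
  intro Cfg G ε τ S ldir zpre Kt hit tcol xmid near θe hθe
  have hP := integral_hitSum_eq_zero_of_fibre hC
  dsimp (config := { zeta := true }) only at hP
  obtain ⟨σ₀, hσ₀, hP⟩ := hP θe hθe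
  refine ⟨min σ₀ (1 / 2), lt_min hσ₀ (by norm_num), fun σ hσ hσlt Φ => ?_⟩
  intro Q t ht V hV ψ hψm hψb N
  have hεh : hsDiameter σ N < 1 / 2 :=
    (hsDiameter_le hσ.le N).trans_lt (hσlt.trans_le (min_le_right _ _))
  have hd : ∀ (a : ℝ) (x : T3) (v w n₀ : V3) (L : V3 → V3),
      |ψ N a x v w n₀ - ∫ ξ, ψ N a x v w (L ξ) ∂(stdGaussian V3)| ≤ 2 := fun a x v w n₀ L => by
    linarith [hψb N a x v w n₀, abs_sub (ψ N a x v w n₀) (∫ ξ, ψ N a x v w (L ξ) ∂(stdGaussian V3)),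
      NearField.abs_integral_le_one (stdGaussian V3) fun ξ => hψb N a x v w (L ξ)]
  rw [integral_const_mul]
  refine mul_eq_zero_of_right _ (hP σ hσ (hσlt.trans_le (min_le_left _ _)) Φ t ht N (fun s y i j =>
    if near σ N y i j then 0 else if V < ‖(y i).2 - (y j).2‖ then 0 else
      ‖(y i).2 - (y j).2‖ ^ 2 * (ψ N s (xmid N y i j) (y i).2 (y j).2 ((ε σ N)⁻¹ • G.sepVec (y i).1 (y j).1) -
        ∫ ξ, ψ N s (xmid N y i j) (y i).2 (y j).2 (ldir (-((y i).2 - (y j).2)) ξ) ∂(stdGaussian V3)))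
    (fun i j => ?_) ⟨2 * V ^ 2, fun s y i j => ?_⟩ fun s i j hij z => ?_)
  · have hy : Measurable fun p : ℝ × Cfg N => p.2 := measurable_snd
    have hvi := NearField.measurable_vel' hy i
    have hvj := NearField.measurable_vel' hy j
    have hxm := NearField.measurable_xmid' hy i j
    refine Measurable.ite (NearField.measurableSet_nearBall _ hy i j) measurable_const
      (Measurable.ite (measurableSet_lt measurable_const (hvi.fun_sub hvj).norm) measurable_const
        (((hvi.fun_sub hvj).norm.pow_const 2).fun_mul ((NearField.measurable_psiAt (hψm N) measurable_fst
          hxm hvi hvj ((NearField.measurable_sepVec' hy i j).fun_const_smul (ε σ N)⁻¹)).fun_sub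
          (NearField.measurable_cosineMean (hψm N) measurable_fst hxm hvi hvj (hvi.fun_sub hvj)))))
  · exact EqCentring.abs_ite_cap_le (norm_nonneg _) (fun h => not_lt.1 h) (hd _ _ _ _ _ _)
  · exact stub_fibreCentring (hsDiameter_pos hσ N) hεh hij θe s V (ψ N) (hψm N) (hψb N) z

end Summit.AtomisticToContinuum.HydrodynamicLimit.Theorems.ContactAngleEquidistributionSketch

end
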